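import Summits.BirchSwinnertonDyer.BirchSwinnertonDyer.Theorems.ManinLocalTwoThreeTameCellIVLocalTwoTorsion
import HarnessLib

/-!
# E-imc-75 on the Kodaira-`IV*` cell in TATE NORMAL FORM: at most one `ℚ₂`-rational 2-division root

Summit `BirchSwinnertonDyer`, route `ManinLocalTwoThree` (cell bsd-f2-manin), crux C2 `ManinOddAtFour`
(stmt-BirchSwinnertonDyer-22967), tame cell, law E-imc-75 `TameTwoLocal.TameCellAtMostOneLocalTwoTorsionPoint`.  The
sibling file `…TameCellIVLocalTwoTorsion` (lead p1 g5) proved the law on the Kodaira-`IV` cell and reduced it to its `IV*` half.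
THIS FILE proves the `IV*` half for curves given (after a `u = 1` change of variables) in the TATE `IV*`-NORMAL FORM at `2`
(Silverman ATAEC IV.9.4, step 8 with `π = 2`): an integral model `[2α, 4α₂, 4α₃, 8α₄, 16α₆]` with `α₃` ODD (the step-8
quadratic `Y² + (a₃/4)Y − a₆/16` is separable over `𝔽₂`).  Its 2-division polynomial is `4·h(x)`,
`h(x) = x³ + B₂x² + B₄x + B₆`, `B₂ = α² + 4α₂`, `B₄ = 4(2α₄ + αα₃)`, `B₆ = 4(α₃² + 4α₆)`, and:

* `root_unique_of_IVstarCubic` — `h` has at most one root in `ℚ₂` (pure `2`-adic analysis): every `ℚ₂`-root is a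
  `2`-adic integer; if `2 ∣ α` no root exists (`x` a unit: `x³` dominates; `x = 2w`: `B₆` dominates since `α₃² + 4α₆` is
  odd); if `α` is odd every root is a UNIT (`x = 4w′`: `B₆` dominates; `x = 2w`, `w` a unit:
  `2w³ + B₂w² + 2(2α₄ + αα₃)w + (α₃² + 4α₆) ≡ 2 + 1 + 2 + 1 ≡ 2 (mod 4)`), and two distinct unit roots `x ≠ y` would give
  `x² + xy + y² + B₂(x + y) + B₄ = 0`, whose left side is odd;
* `isLocalTwoTorsionX_unique_of_IVstarNormalForm` — hence for `W` with a `u = 1` change to such a model, at most one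
  `x : ℚ₂` with `IsLocalTwoTorsionX W x`;
* `tameCellAtMostOneLocalTwoTorsionPoint_of_IVstarNormalForm` — E-imc-75 ⟸ «every globally minimal `W` with `4 ∥ N_W`
  and `ord₂(Δ_min) = 8` admits a `u = 1` change to the `IV*`-normal form» (Tate's algorithm, steps 6–8, stated inline: the
  only remaining input, pure bookkeeping over `kodairaSymbolAt = IV*`).

Nothing about BSD or Manin's conjecture is proved. [cite: SilvermanATAEC1994, IV.9.4 (step 8) and Table 4.1]
-/

set_option autoImplicit false
set_option linter.dupNamespace false

noncomputable section

open scoped Classical NumberField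
open WeierstrassCurve IsDedekindDomain Rat.HeightOneSpectrum Literature.NumberTheory.EllipticCurves
open Summit.BirchSwinnertonDyer.Rank1Residual.ManinAdditive.TameTwoLocal

namespace Summit.BirchSwinnertonDyer.BirchSwinnertonDyer.Theorems.ManinLocalTwoThree

/-! ### §1 Small `2`-adic tools -/

/-- If `‖b‖ < ‖a‖` then `a + b ≠ 0` (ultrametric). [folklore] -/
theorem padic_add_ne_zero_of_norm_lt {p : ℕ} [Fact p.Prime] {a b : ℚ_[p]} (h : ‖b‖ < ‖a‖) : a + b ≠ 0 := by
  intro h0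
  have : a = -b := by linear_combination h0
  rw [this, norm_neg] at h
  exact lt_irrefl _ h

/-- `2⁻ⁿ < ‖(k : ℚ₂)‖` when `2ⁿ ∤ k`. [folklore] -/
theorem padicTwo_pow_lt_norm_int_of_not_dvd {k : ℤ} {n : ℕ} (h : ¬ (2 : ℤ) ^ n ∣ k) :
    (2 : ℝ) ^ (-(n : ℤ)) < ‖(k : ℚ_[2])‖ := by
  by_contra hle
  rw [not_lt] at hle
  have := (Padic.norm_int_le_pow_iff_dvd k n).mp (by exact_mod_cast hle)
  exact h (by exact_mod_cast this)

/-- A non-unit `2`-adic integer is `2w`. [folklore] -/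
theorem padicInt_two_eq_two_mul_of_not_isUnit {x : ℤ_[2]} (hx : ¬ IsUnit x) : ∃ w : ℤ_[2], x = 2 * w := by
  have hm : x ∈ IsLocalRing.maximalIdeal ℤ_[2] := (IsLocalRing.mem_maximalIdeal _).mpr hx
  rw [PadicInt.maximalIdeal_eq_span_p, Ideal.mem_span_singleton'] at hm
  obtain ⟨w, hw⟩ := hm
  exact ⟨w, by rw [← hw]; push_cast; ring⟩

/-- The image of a unit of `ℤ₂` in `ZMod 2` is `1`; the image of an odd integer in `ZMod 2` is `1`. [folklore] -/
theorem toZMod_eq_one_of_isUnit {x : ℤ_[2]} (hx : IsUnit x) : PadicInt.toZMod x = 1 := by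
  have hu : IsUnit (PadicInt.toZMod (p := 2) x) := hx.map _
  have key : ∀ z : ZMod 2, z ≠ 0 → z = 1 := by decide
  exact key _ hu.ne_zero

/-- An odd integer is `1` in `ZMod 2`. [folklore] -/
theorem intCast_zmod_two_of_odd {a : ℤ} (ha : ¬ (2 : ℤ) ∣ a) : (a : ZMod 2) = 1 := by
  have h0 : (a : ZMod 2) ≠ 0 := by
    rw [ne_eq, ZMod.intCast_zmod_eq_zero_iff_dvd]; exact_mod_cast ha
  have key : ∀ z : ZMod 2, z ≠ 0 → z = 1 := by decide
  exact key _ h0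

/-- An odd integer is `1` or `3` in `ZMod 4`. [folklore] -/
theorem intCast_zmod_four_of_odd {a : ℤ} (ha : ¬ (2 : ℤ) ∣ a) : (a : ZMod 4) = 1 ∨ (a : ZMod 4) = 3 := by
  have h : a % ((4 : ℕ) : ℤ) = 1 ∨ a % ((4 : ℕ) : ℤ) = 3 := by omega
  rcases h with h | h
  · left; rw [← ZMod.intCast_mod a 4, h]; rfl
  · right; rw [← ZMod.intCast_mod a 4, h]; rfl

/-- A unit of `ZMod 4` is `1` or `3`. [folklore] -/
theorem zmod_four_eq_of_isUnit {z : ZMod 4} (hz : IsUnit z) : z = 1 ∨ z = 3 := by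
  obtain ⟨w, hw⟩ := hz.exists_right_inv
  have key : ∀ z w : ZMod 4, z * w = 1 → z = 1 ∨ z = 3 := by decide
  exact key z w hw

/-- A unit of `ℤ₂` is `1` or `3` in `ZMod 4` (`toZModPow 2`). [folklore] -/
theorem toZModPow_two_of_isUnit {x : ℤ_[2]} (hx : IsUnit x) :
    (PadicInt.toZModPow 2 x : ZMod 4) = 1 ∨ (PadicInt.toZModPow 2 x : ZMod 4) = 3 :=
  zmod_four_eq_of_isUnit (hx.map (PadicInt.toZModPow (p := 2) 2))

/-! ### §2 Norm bookkeeping in `ℚ₂` -/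

/-- `‖x‖ < 1/2 ⟹ ‖x‖ ≤ 1/4` in `ℚ₂`. [folklore] -/
theorem padicTwo_norm_le_quarter_of_lt_half {x : ℚ_[2]} (h : ‖x‖ < 1 / 2) : ‖x‖ ≤ 1 / 4 := by
  have := (Padic.norm_le_pow_iff_norm_lt_pow_add_one x (-2)).mpr (by norm_num; exact h)
  norm_num at this; exact this

/-- Three terms each of norm `< c` sum to norm `< c` (ultrametric). [folklore] -/
theorem padic_norm_add3_lt {p : ℕ} [Fact p.Prime] {t₁ t₂ t₃ : ℚ_[p]} {c : ℝ} (h₁ : ‖t₁‖ < c) (h₂ : ‖t₂‖ < c)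
    (h₃ : ‖t₃‖ < c) : ‖t₁ + t₂ + t₃‖ < c :=
  lt_of_le_of_lt (Padic.nonarchimedean _ _)
    (max_lt (lt_of_le_of_lt (Padic.nonarchimedean _ _) (max_lt h₁ h₂)) h₃)

/-! ### §3 The cubic of the `IV*`-normal form has at most one `ℚ₂`-root -/

section Cubic

variable {α α₂ α₃ α₄ α₆ : ℤ}

/-- `‖4(α₃² + 4α₆)‖₂ > 1/8` for odd `α₃`. -/
private theorem norm_B₆_gt (hα₃ : ¬ (2 : ℤ) ∣ α₃) :
    (1 : ℝ) / 8 < ‖((4 * (α₃ ^ 2 + 4 * α₆) : ℤ) : ℚ_[2])‖ := by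
  have h := padicTwo_pow_lt_norm_int_of_not_dvd (n := 3) (k := 4 * (α₃ ^ 2 + 4 * α₆)) ?_
  · have e : (2 : ℝ) ^ (-((3 : ℕ) : ℤ)) = 1 / 8 := by norm_num
    rw [e] at h; exact h
  · intro h
    have hodd : Odd α₃ := Int.not_even_iff_odd.mp (fun he => hα₃ (even_iff_two_dvd.mp he))
    have hodd' : Odd (α₃ ^ 2 + 4 * α₆) := (hodd.pow).add_even ⟨2 * α₆, by ring⟩
    have h2 : (2 : ℤ) ∣ α₃ ^ 2 + 4 * α₆ := by obtain ⟨k, hk⟩ := h; exact ⟨k, by omega⟩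
    exact (Int.not_even_iff_odd.mpr hodd') (even_iff_two_dvd.mpr h2)

/-- **The `2`-adic root analysis of the `IV*`-cubic.**  For integers `α, α₂, α₃, α₄, α₆` with `α₃` ODD, the cubic
`x³ + (α² + 4α₂)x² + 4(2α₄ + αα₃)x + 4(α₃² + 4α₆)` has at most one root in `ℚ₂`.  (Proof in the module
docstring.) [folklore] -/
theorem root_unique_of_IVstarCubic (hα₃ : ¬ (2 : ℤ) ∣ α₃) {x y : ℚ_[2]}
    (hx : x ^ 3 + ((α ^ 2 + 4 * α₂ : ℤ) : ℚ_[2]) * x ^ 2 + ((4 * (2 * α₄ + α * α₃) : ℤ) : ℚ_[2]) * x +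
      ((4 * (α₃ ^ 2 + 4 * α₆) : ℤ) : ℚ_[2]) = 0)
    (hy : y ^ 3 + ((α ^ 2 + 4 * α₂ : ℤ) : ℚ_[2]) * y ^ 2 + ((4 * (2 * α₄ + α * α₃) : ℤ) : ℚ_[2]) * y +
      ((4 * (α₃ ^ 2 + 4 * α₆) : ℤ) : ℚ_[2]) = 0) : x = y := by
  -- two local norm tools (kept local: the tree has them under other routes' namespaces)
  have padicTwo_norm_int_le_of_dvd : ∀ {k : ℤ} {n : ℕ}, (2 : ℤ) ^ n ∣ k → ‖(k : ℚ_[2])‖ ≤ (2 : ℝ) ^ (-(n : ℤ)) :=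
    fun {k n} h => by
      have := (Padic.norm_int_le_pow_iff_dvd k n).mpr (by exact_mod_cast h)
      exact_mod_cast this
  have padicTwo_norm_le_half_of_lt_one : ∀ {x : ℚ_[2]}, ‖x‖ < 1 → ‖x‖ ≤ 1 / 2 := fun {x} h => by
    have := (Padic.norm_le_pow_iff_norm_lt_pow_add_one x (-1)).mpr (by norm_num; exact h)
    norm_num at this; exact this
  -- notation and norm facts
  set B₂ : ℤ := α ^ 2 + 4 * α₂ with hB₂
  set B₄ : ℤ := 4 * (2 * α₄ + α * α₃) with hB₄
  set B₆ : ℤ := 4 * (α₃ ^ 2 + 4 * α₆) with hB₆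
  have nB₂ : ‖(B₂ : ℚ_[2])‖ ≤ 1 := Padic.norm_int_le_one _
  have nB₄ : ‖(B₄ : ℚ_[2])‖ ≤ 1 / 4 := by
    have := padicTwo_norm_int_le_of_dvd (n := 2) (k := B₄) ⟨2 * α₄ + α * α₃, by rw [hB₄]; ring⟩
    norm_num at this; exact this
  have nB₆ : ‖(B₆ : ℚ_[2])‖ ≤ 1 / 4 := by
    have := padicTwo_norm_int_le_of_dvd (n := 2) (k := B₆) ⟨α₃ ^ 2 + 4 * α₆, by rw [hB₆]; ring⟩
    norm_num at this; exact this
  have nB₆' : 1 / 8 < ‖(B₆ : ℚ_[2])‖ := norm_B₆_gt (α₆ := α₆) hα₃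
  -- generic facts about a root `t`
  have hroot : ∀ {t : ℚ_[2]}, t ^ 3 + (B₂ : ℚ_[2]) * t ^ 2 + (B₄ : ℚ_[2]) * t + (B₆ : ℚ_[2]) = 0 →
      ‖t‖ ≤ 1 := fun ht => padic_norm_le_one_of_monic_cubic_root nB₂ (by linarith) (by linarith) ht
  -- (i) no root with `‖t‖ ≤ 1/4`
  have hsmall : ∀ {t : ℚ_[2]}, t ^ 3 + (B₂ : ℚ_[2]) * t ^ 2 + (B₄ : ℚ_[2]) * t + (B₆ : ℚ_[2]) = 0 →
      ¬ ‖t‖ ≤ 1 / 4 := by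
    intro t ht hle
    refine padic_add_ne_zero_of_norm_lt (a := (B₆ : ℚ_[2])) (b := t ^ 3 + (B₂ : ℚ_[2]) * t ^ 2 + (B₄ : ℚ_[2]) * t)
      (padic_norm_add3_lt ?_ ?_ ?_) (by rw [← ht]; ring)
    · rw [norm_pow]
      calc ‖t‖ ^ 3 ≤ (1 / 4) ^ 3 := by gcongr
        _ < 1 / 8 := by norm_num
        _ < _ := nB₆'
    · rw [norm_mul, norm_pow]
      calc ‖(B₂ : ℚ_[2])‖ * ‖t‖ ^ 2 ≤ 1 * (1 / 4) ^ 2 := by gcongr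
        _ < 1 / 8 := by norm_num
        _ < _ := nB₆'
    · rw [norm_mul]
      calc ‖(B₄ : ℚ_[2])‖ * ‖t‖ ≤ (1 / 4) * (1 / 4) := by gcongr
        _ < 1 / 8 := by norm_num
        _ < _ := nB₆'
  by_cases hα : (2 : ℤ) ∣ α
  · ---------------------------------------------------------------- Case `2 ∣ α`: no root at all
    exfalso
    obtain ⟨β, hβ⟩ := hα
    have nB₂' : ‖(B₂ : ℚ_[2])‖ ≤ 1 / 4 := by
      have := padicTwo_norm_int_le_of_dvd (n := 2) (k := B₂) ⟨β ^ 2 + α₂, by rw [hB₂, hβ]; ring⟩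
      norm_num at this; exact this
    have nB₄' : ‖(B₄ : ℚ_[2])‖ ≤ 1 / 8 := by
      have := padicTwo_norm_int_le_of_dvd (n := 3) (k := B₄) ⟨α₄ + β * α₃, by rw [hB₄, hβ]; ring⟩
      norm_num at this; exact this
    have hx1 := hroot hx
    rcases hx1.lt_or_eq with hlt | heq
    · -- `‖x‖ ≤ 1/2`: `B₆` dominates
      have hx2 := padicTwo_norm_le_half_of_lt_one hlt
      refine padic_add_ne_zero_of_norm_lt (a := (B₆ : ℚ_[2]))
        (b := x ^ 3 + (B₂ : ℚ_[2]) * x ^ 2 + (B₄ : ℚ_[2]) * x) (padic_norm_add3_lt ?_ ?_ ?_) (by rw [← hx]; ring)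
      · rw [norm_pow]
        calc ‖x‖ ^ 3 ≤ (1 / 2) ^ 3 := by gcongr
          _ = 1 / 8 := by norm_num
          _ < _ := nB₆'
      · rw [norm_mul, norm_pow]
        calc ‖(B₂ : ℚ_[2])‖ * ‖x‖ ^ 2 ≤ (1 / 4) * (1 / 2) ^ 2 := by gcongr
          _ < 1 / 8 := by norm_num
          _ < _ := nB₆'
      · rw [norm_mul]
        calc ‖(B₄ : ℚ_[2])‖ * ‖x‖ ≤ (1 / 8) * (1 / 2) := by gcongr
          _ < 1 / 8 := by norm_num
          _ < _ := nB₆'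
    · -- `‖x‖ = 1`: `x³` dominates
      refine padic_add_ne_zero_of_norm_lt (a := x ^ 3)
        (b := (B₂ : ℚ_[2]) * x ^ 2 + (B₄ : ℚ_[2]) * x + (B₆ : ℚ_[2])) ?_ (by rw [← hx]; ring)
      rw [norm_pow, heq, one_pow]
      refine padic_norm_add3_lt ?_ ?_ ?_
      · rw [norm_mul, norm_pow, heq, one_pow, mul_one]; linarith
      · rw [norm_mul, heq, mul_one]; linarith
      · linarith
  · ---------------------------------------------------------------- Case `α` odd: roots are units, at most one
    -- (ii) no root with `‖t‖ = 1/2` (the mod-4 argument)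
    have hhalf : ∀ {t : ℚ_[2]}, t ^ 3 + (B₂ : ℚ_[2]) * t ^ 2 + (B₄ : ℚ_[2]) * t + (B₆ : ℚ_[2]) = 0 →
        ‖t‖ ≠ 1 / 2 := by
      intro t ht hn
      -- `w = t/2` is a unit of `ℤ₂`
      have h2 : ‖(2 : ℚ_[2])‖ = 1 / 2 := by
        have := Padic.norm_p (p := 2); norm_num at this ⊢; exact_mod_cast this
      have hwn : ‖t / 2‖ = 1 := by rw [norm_div, hn, h2]; norm_num
      set w : ℤ_[2] := ⟨t / 2, hwn.le⟩ with hwdef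
      have hwu : IsUnit w := PadicInt.isUnit_iff.mpr (by rw [PadicInt.norm_def]; exact hwn)
      have htw : t = 2 * (w : ℚ_[2]) := by show t = 2 * (t / 2); ring
      -- the integer equation `2w³ + B₂w² + 2γw + δ = 0`, `γ = 2α₄ + αα₃`, `δ = α₃² + 4α₆`
      set γ : ℤ := 2 * α₄ + α * α₃ with hγ
      set δ : ℤ := α₃ ^ 2 + 4 * α₆ with hδ
      set gz : ℤ_[2] := 2 * w ^ 3 + (B₂ : ℤ_[2]) * w ^ 2 + 2 * (γ : ℤ_[2]) * w + (δ : ℤ_[2]) with hgz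
      have hgzQ : (gz : ℚ_[2]) = 2 * (w : ℚ_[2]) ^ 3 + (B₂ : ℚ_[2]) * (w : ℚ_[2]) ^ 2 +
          2 * (γ : ℚ_[2]) * (w : ℚ_[2]) + (δ : ℚ_[2]) := by
        have c2 : ((2 : ℤ_[2]) : ℚ_[2]) = 2 := by exact_mod_cast PadicInt.coe_natCast 2
        rw [hgz]; push_cast [PadicInt.coe_intCast]; simp only [c2]
      have cB₄ : (B₄ : ℚ_[2]) = 4 * (γ : ℚ_[2]) := by rw [hB₄]; push_cast; ring
      have cB₆ : (B₆ : ℚ_[2]) = 4 * (δ : ℚ_[2]) := by rw [hB₆]; push_cast; ring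
      have hg : gz = 0 := by
        have h4 : (4 : ℚ_[2]) ≠ 0 := by norm_num
        have e : (4 : ℚ_[2]) * (gz : ℚ_[2]) = t ^ 3 + (B₂ : ℚ_[2]) * t ^ 2 + (B₄ : ℚ_[2]) * t + (B₆ : ℚ_[2]) := by
          rw [hgzQ, cB₄, cB₆, htw]; ring
        rw [ht] at e
        exact PadicInt.coe_eq_zero.mp ((mul_eq_zero.mp e).resolve_left h4)
      -- reduce mod 4
      have hmod := congrArg (PadicInt.toZModPow (p := 2) 2) hg
      rw [hgz, map_zero] at hmod
      simp only [map_add, map_mul, map_pow, map_intCast, map_ofNat] at hmod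
      have h4z : (4 : ZMod (2 ^ 2)) = 0 := by decide
      have eB₂ : ((B₂ : ℤ) : ZMod (2 ^ 2)) = (α : ZMod (2 ^ 2)) ^ 2 + 4 * (α₂ : ZMod (2 ^ 2)) := by
        rw [hB₂]; push_cast; ring
      have eγ : ((γ : ℤ) : ZMod (2 ^ 2)) = 2 * (α₄ : ZMod (2 ^ 2)) + (α : ZMod (2 ^ 2)) * (α₃ : ZMod (2 ^ 2)) := by
        rw [hγ]; push_cast; ring
      have eδ : ((δ : ℤ) : ZMod (2 ^ 2)) = (α₃ : ZMod (2 ^ 2)) ^ 2 + 4 * (α₆ : ZMod (2 ^ 2)) := by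
        rw [hδ]; push_cast; ring
      rw [eB₂, eγ, eδ] at hmod
      have hred : (2 * PadicInt.toZModPow 2 w ^ 3 + (α : ZMod (2 ^ 2)) ^ 2 * PadicInt.toZModPow 2 w ^ 2 +
          2 * ((α : ZMod (2 ^ 2)) * (α₃ : ZMod (2 ^ 2))) * PadicInt.toZModPow 2 w + (α₃ : ZMod (2 ^ 2)) ^ 2
            : ZMod (2 ^ 2)) = 0 := by
        rw [← hmod]
        linear_combination (-(α₂ : ZMod (2 ^ 2)) * PadicInt.toZModPow 2 w ^ 2 - (α₄ : ZMod (2 ^ 2)) * PadicInt.toZModPow 2 w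
          - (α₆ : ZMod (2 ^ 2))) * h4z
      obtain hw | hw := toZModPow_two_of_isUnit hwu <;>
        obtain ha | ha := intCast_zmod_four_of_odd hα <;>
          obtain ha3 | ha3 := intCast_zmod_four_of_odd hα₃ <;>
            · rw [show (PadicInt.toZModPow 2 w : ZMod (2 ^ 2)) = _ from hw,
                show ((α : ℤ) : ZMod (2 ^ 2)) = _ from ha, show ((α₃ : ℤ) : ZMod (2 ^ 2)) = _ from ha3] at hred
              revert hred; decide
    -- so every root is a UNIT
    have hunit : ∀ {t : ℚ_[2]}, t ^ 3 + (B₂ : ℚ_[2]) * t ^ 2 + (B₄ : ℚ_[2]) * t + (B₆ : ℚ_[2]) = 0 → ‖t‖ = 1 := by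
      intro t ht
      rcases (hroot ht).lt_or_eq with hlt | heq
      · exfalso
        have h2 := padicTwo_norm_le_half_of_lt_one hlt
        rcases h2.lt_or_eq with hlt2 | heq2
        · exact hsmall ht (padicTwo_norm_le_quarter_of_lt_half hlt2)
        · exact hhalf ht heq2
      · exact heq
    -- (iii) two distinct unit roots are impossible: `x² + xy + y² + B₂(x + y) + B₄` is odd
    by_contra hxy
    have hx1 := hunit hx
    have hy1 := hunit hy
    have hQ : x ^ 2 + x * y + y ^ 2 + (B₂ : ℚ_[2]) * (x + y) + (B₄ : ℚ_[2]) = 0 := by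
      have hsub : (x - y) * (x ^ 2 + x * y + y ^ 2 + (B₂ : ℚ_[2]) * (x + y) + (B₄ : ℚ_[2])) = 0 := by
        linear_combination hx - hy
      rcases mul_eq_zero.mp hsub with h | h
      · exact absurd (sub_eq_zero.mp h) hxy
      · exact h
    set xz : ℤ_[2] := ⟨x, hx1.le⟩ with hxz
    set yz : ℤ_[2] := ⟨y, hy1.le⟩ with hyz
    have hxu : IsUnit xz := PadicInt.isUnit_iff.mpr (by rw [PadicInt.norm_def]; exact hx1)
    have hyu : IsUnit yz := PadicInt.isUnit_iff.mpr (by rw [PadicInt.norm_def]; exact hy1)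
    set Qz : ℤ_[2] := xz ^ 2 + xz * yz + yz ^ 2 + (B₂ : ℤ_[2]) * (xz + yz) + (B₄ : ℤ_[2]) with hQzdef
    have hQz : Qz = 0 := by
      have : (Qz : ℚ_[2]) = 0 := by rw [hQzdef]; push_cast [PadicInt.coe_intCast]; exact hQ
      exact PadicInt.coe_eq_zero.mp this
    have hmod := congrArg (PadicInt.toZMod (p := 2)) hQz
    rw [hQzdef, map_zero] at hmod
    simp only [map_add, map_mul, map_pow, map_intCast] at hmod
    have eB₄ : ((B₄ : ℤ) : ZMod 2) = 0 := by
      rw [ZMod.intCast_zmod_eq_zero_iff_dvd]; exact ⟨2 * (2 * α₄ + α * α₃), by rw [hB₄]; ring⟩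
    rw [toZMod_eq_one_of_isUnit hxu, toZMod_eq_one_of_isUnit hyu, eB₄] at hmod
    revert hmod
    generalize ((B₂ : ℤ) : ZMod 2) = b
    revert b; decide

end Cubic

/-! ### §4 From the `IV*`-normal form to `W` -/

/-- On an integral model in `IV*`-normal form `[2α, 4α₂, 4α₃, 8α₄, 16α₆]` the local 2-division roots are the roots of
the cubic of §3 (`4x³ + b₂x² + 2b₄x + b₆ = 4·h(x)`). [folklore] -/
theorem hIV_eq_zero_of_isLocalTwoTorsionX_map (M : WeierstrassCurve ℤ) {α α₂ α₃ α₄ α₆ : ℤ}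
    (h₁ : M.a₁ = 2 * α) (h₂ : M.a₂ = 4 * α₂) (h₃ : M.a₃ = 4 * α₃) (h₄ : M.a₄ = 8 * α₄) (h₆ : M.a₆ = 16 * α₆)
    {x : ℚ_[2]} (hx : IsLocalTwoTorsionX (M.map (Int.castRingHom ℚ)) x) :
    x ^ 3 + ((α ^ 2 + 4 * α₂ : ℤ) : ℚ_[2]) * x ^ 2 + ((4 * (2 * α₄ + α * α₃) : ℤ) : ℚ_[2]) * x +
      ((4 * (α₃ ^ 2 + 4 * α₆) : ℤ) : ℚ_[2]) = 0 := by
  unfold IsLocalTwoTorsionX at hx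
  simp only [WeierstrassCurve.b₂, WeierstrassCurve.b₄, WeierstrassCurve.b₆, map_a₁, map_a₂, map_a₃, map_a₄, map_a₆,
    eq_intCast, h₁, h₂, h₃, h₄, h₆] at hx
  push_cast at hx ⊢
  linear_combination hx / 4

/-- **E-imc-75 for a curve with a `IV*`-normal form at `2` (PROVED).**  If `W` admits a `u = 1` change of variables to an
integral model `[2α, 4α₂, 4α₃, 8α₄, 16α₆]` with `α₃` odd (Tate's `IV*`-normal form at `2`), then the 2-division polynomial of
`W` has at most one root in `ℚ₂`. [cite: SilvermanATAEC1994, IV.9.4 (step 8)] -/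
theorem isLocalTwoTorsionX_unique_of_IVstarNormalForm (W : WeierstrassCurve ℚ) (C : VariableChange ℚ)
    (M : WeierstrassCurve ℤ) (hu : C.u = 1) (hCW : C • W = M.map (Int.castRingHom ℚ)) {α α₂ α₃ α₄ α₆ : ℤ}
    (h₁ : M.a₁ = 2 * α) (h₂ : M.a₂ = 4 * α₂) (h₃ : M.a₃ = 4 * α₃) (hα₃ : ¬ (2 : ℤ) ∣ α₃) (h₄ : M.a₄ = 8 * α₄)
    (h₆ : M.a₆ = 16 * α₆) :
    ∀ x y : ℚ_[2], IsLocalTwoTorsionX W x → IsLocalTwoTorsionX W y → x = y := by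
  intro x y hx hy
  have hx' := hIV_eq_zero_of_isLocalTwoTorsionX_map M h₁ h₂ h₃ h₄ h₆
    (hCW ▸ isLocalTwoTorsionX_smul_sub_of_u_eq_one W C hu hx)
  have hy' := hIV_eq_zero_of_isLocalTwoTorsionX_map M h₁ h₂ h₃ h₄ h₆
    (hCW ▸ isLocalTwoTorsionX_smul_sub_of_u_eq_one W C hu hy)
  have hxy : x - (C.r : ℚ_[2]) = y - (C.r : ℚ_[2]) := root_unique_of_IVstarCubic hα₃ hx' hy'
  simpa using hxy

/-! ### §5 E-imc-75 modulo the Tate `IV*`-normal form -/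

/-- **E-imc-75 ⟸ «every tame-cell curve with `ord₂(Δ_min) = 8` has a `IV*`-normal form at `2`»** (Tate's algorithm,
steps 6–8, for a globally minimal `W` with `kodairaSymbolAt 2 = IV*`; stated inline — the only input of E-imc-75 not proved
in this file and its sibling).  CONDITIONAL edge; with it `TameCellAtMostOneLocalTwoTorsionPoint` follows from the `IV`
theorem and the `IV*` root analysis. [cite: SilvermanATAEC1994, IV.9.4 (steps 6–8) and Table 4.1] -/
theorem tameCellAtMostOneLocalTwoTorsionPoint_of_IVstarNormalForm
    (hNF : ∀ (W : WeierstrassCurve ℚ) [W.IsElliptic] [W.IsGloballyMinimal],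
      2 ^ 2 ∣ W.conductorNorm ℤ → ¬ 2 ^ 3 ∣ W.conductorNorm ℤ → padicValInt 2 W.minimalDiscriminantInt = 8 →
      ∃ (C : VariableChange ℚ) (M : WeierstrassCurve ℤ) (α α₂ α₃ α₄ α₆ : ℤ),
        C.u = 1 ∧ C • W = M.map (Int.castRingHom ℚ) ∧ M.a₁ = 2 * α ∧ M.a₂ = 4 * α₂ ∧ M.a₃ = 4 * α₃ ∧
        ¬ (2 : ℤ) ∣ α₃ ∧ M.a₄ = 8 * α₄ ∧ M.a₆ = 16 * α₆) :
    TameCellAtMostOneLocalTwoTorsionPoint := by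
  refine tameCellAtMostOneLocalTwoTorsionPoint_of_IVstar ?_
  intro W _ _ h4 h8 hΔ8 x y hx hy
  obtain ⟨C, M, α, α₂, α₃, α₄, α₆, hu, hCW, h₁, h₂, h₃, hα₃, h₄, h₆⟩ := hNF W h4 h8 hΔ8
  exact isLocalTwoTorsionX_unique_of_IVstarNormalForm W C M hu hCW h₁ h₂ h₃ hα₃ h₄ h₆ x y hx hy

end Summit.BirchSwinnertonDyer.BirchSwinnertonDyer.Theorems.ManinLocalTwoThree

end
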